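import Mathlib
import HarnessLib
import Summits.ValiantsHypothesis.ValiantsHypothesis.Theorems.DefinabilityGapAffineRung
import Literature.Computability.AlgebraicComplexity.CoeffDefinable
import Literature.Computability.AlgebraicComplexity.RealTauConjectureAssembly
import Literature.Computability.AlgebraicComplexity.ValiantCriterion
import Literature.Computability.AlgebraicComplexity.ValiantConjectureEquivProofs
import Literature.Computability.AlgebraicComplexity.VNPClosedUnderProjection
import Literature.Computability.AlgebraicComplexity.KRSTDesign
import Literature.Computability.Complexity.PolyAdviceClosure
import Literature.Computability.Complexity.ProbabilisticClasses
import Literature.NumberTheory.LFunctions.DedekindZeta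

/-!
# DefinabilityGap — the CH cut of the definability crux K2c (route-independent kernel, definition-free)

[topic Summits/ValiantsHypothesis/ValiantsHypothesis/Theorems]

Support for `stmt-ValiantsHypothesis-23546` (`KIAnnihilatorDefinableOnCollapse`, K2c) of `route-ValiantsHypothesis-DefinabilityGap`:
the split `K2c ⟸ K2ch ∧ LiftCH` ALONG THE COUNTING HIERARCHY (decomp-valiant workshop, lens 5, NODE v3; critic CRITIC-LEDGER
21:05:02Z / STATUS 21:29:26Z: "the one definability cut I would clear as a split remains the CH cut"). This module imports NO Theses
file and declares NO `def`: every statement is spelled out over the tree objects `qOf`, `kiPer` (`Theorems.DefinabilityGapAffineRung`);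
the route's items K2c (23546), K1 (23547), K2u (23737) inline `kiPer`, so the hypotheses / conclusions below are DEFINITIONALLY those
items (the lens file `pub/decomp-valiant/decomp-val-lens-5/v3/DefinabilityGapCH.lean`, which imports the route file, proves the same
glue against the route decls and names the pieces `KIAnnihilatorCHDefinable`, `CollapseLiftsCH`, `ValiantCriterionCoeff`, `PPOnCollapseGRH`).

The pieces (written inline below):
* **K2ch** — `∃ A : ∀ m, MvPolynomial (Fin 3 → Fin (qOf m)) ℤ, IsPFamily A ∧ IsCoeffDefinableIn (polyAdvice CH) A ∧ ∃ m₁, ∀ m ≥ m₁,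
  A m ≠ 0 ∧ bind₁ (kiPer m) (map (Int.castRingHom ℂ) (A m)) = 0`: an eventually-nonzero INTEGER p-family in the vanishing ideal of the
  KI-planted permanent map whose Koiran–Perifel coefficient function is in `CH/poly`. OPEN; not implied by `VP ≠ VNP`.
* **LiftCH** — `VP ℂ = VNP ℂ → ∀ A, IsPFamily A → IsCoeffDefinableIn (polyAdvice CH) A → IsVNPFamily (map ∘ A)`. IN PRINT MODULO GRH:
  Bürgisser 2009 (CC 18; STACS 2007 Lemma 5; ECCC TR06-113 Lemma 2.5) + Bürgisser 2000 TCS Cor. 1.2(1) give `VP_ℂ = VNP_ℂ ∧ GRH ⟹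
  PP ⊆ P/poly ⟹ CH ⊆ P/poly` (2024 survey Thm. 4.10(2), arXiv:2406.06217 p. 17), then Valiant's criterion (survey Prop. 2.27 p. 10;
  Koiran–Perifel 2011 Lemma 3, arXiv:0710.0360 p. 7; GRH caveat = their Remark 4, p. 8); the whole chain is the proof sketch of
  Chatterjee–Tengse 2023 Prop. 2.27 (arXiv:2309.07612 v1 Prop. 33, p. 11) verbatim. Kernel here (`collapseLiftsCH_of_GRH`) modulo three
  named inputs written as hypotheses: `ERH → VP ℂ = VNP ℂ → PP ⊆ PPoly` (= the statement of the tree theorem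
  `Literature.Computability.AlgebraicComplexity.PP_subset_PPoly_of_VP_eq_VNP ℂ`, module `SharpPBooleanPartsPPoly`, whose olean is not in
  the farm snapshot this week), `ERH` itself, and Valiant's criterion in coefficient-language form for integer p-families on `𝔽_q³`
  (LIBRARY GAP: tree has `isVNPFamily_circuitSum`, `isVNPFamily_gapCertCountGen`, `DefVNP.isVNPFamily_hPoly`, `IsVNPFamily.aeval`; the
  Boolean plumbing `e ↦ encCoeffBitQuery` is missing).
* **Glue** `k2c_of_chCut : K2ch → LiftCH → K2c` and `vh_of_chCut : K1 → K2ch → LiftCH → VP_ℂ ≠ VNP_ℂ` (0 sorry), the latter through the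
  route-independent re-proof `vh_of_kiPlantedHitting_of_k2c` of the gate's `closes : K1 → K2c → VH`.
* **Dial**: monotonicity in the class; the `P/poly` notch gives the unconditional K2u by the criterion alone; the `PSPACE/poly` notch
  (coefficient form of the landed rung `Theorems.DefinabilityGapK2cVPSPACE0Rung.k2c_vpspace0b_rung`, via Poizat / KP09 Prop. 2.21 —
  not typed) gives K2ch under `PSPACE/poly ⊆ CH/poly`, so `¬K2ch` is a Boolean separation (Chatterjee–Tengse 2023 Prop. 2.26–2.27).

HONEST: `VP ≠ VNP` is not proved; K2ch may be false; GRH is a conjecture input of LiftCH only.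
-/

noncomputable section

open MvPolynomial
open Literature.Computability.Complexity
open Literature.Computability.AlgebraicComplexity
open Summit.ValiantsHypothesis.ValiantsHypothesis.Theorems.DefinabilityGapAffineRung (qOf qOf_spec sq_le_qOf quadDesign kiPer)

namespace Summit.ValiantsHypothesis.ValiantsHypothesis.Theorems.DefinabilityGapCHCut

/-- The variable type `𝔽_q³` is encodable (needed by `IsCoeffDefinableIn`). [folklore] -/
example (m : ℕ) : Encodable (Fin 3 → Fin (qOf m)) := inferInstance

/-! ### 1. The gate's `closes`, route-independently: K1 ⟹ K2c ⟹ VP_ℂ ≠ VNP_ℂ -/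

/-- Arithmetic of the seam: `m^c + c ≤ q^(c+e+1)` for `q = qOf m`. [folklore] -/
theorem pow_add_le_qOf_pow (m c e : ℕ) : m ^ c + c ≤ qOf m ^ (c + e + 1) := by
  have hq : m * m + 1 ≤ qOf m ∧ (qOf m).Prime := qOf_spec m
  have hq2 : 2 ≤ qOf m := hq.2.two_le
  have hmq : m ≤ qOf m := (Nat.le_mul_self m).trans ((Nat.le_succ _).trans hq.1)
  have h1 : m ^ c ≤ qOf m ^ c := Nat.pow_le_pow_left hmq c
  have h2 : c ≤ 2 ^ c := (Nat.lt_two_pow_self).le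
  have h3 : 2 ^ c ≤ qOf m ^ c := Nat.pow_le_pow_left hq2 c
  have h4 : qOf m ^ c * 2 ≤ qOf m ^ (c + e + 1) := by
    calc qOf m ^ c * 2 ≤ qOf m ^ c * qOf m := Nat.mul_le_mul_left _ hq2
      _ = qOf m ^ (c + 1) := (pow_succ _ c).symm
      _ ≤ qOf m ^ (c + e + 1) := Nat.pow_le_pow_right (by omega) (by omega)
  omega

/-- **`K1 → K2c → VP_ℂ ≠ VNP_ℂ`** (the gate's `Theses.DefinabilityGap.closes`, re-proved over `kiPer`): under the collapse the VNP
annihilator family of K2c is in VP, so `A_m` has size `≤ m^c + c` and degree `≤ m^d + d`, both `≤ q^{c+d+1}`, and K1 at level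
`b = c + d + 1` beyond `m₁` gives an `m` where no such nonzero circuit vanishes on `G_m`. [cite: KabanetsImpagliazzo2003, Thm. 7.7] -/
theorem vh_of_kiPlantedHitting_of_k2c
    (h₁ : ∀ b m₀ : ℕ, ∃ m, m₀ ≤ m ∧ ∀ D : MvPolynomial (Fin 3 → Fin (qOf m)) ℂ, D ≠ 0 →
      complexity D ≤ qOf m ^ b → D.totalDegree ≤ qOf m ^ b → bind₁ (kiPer m) D ≠ 0)
    (h₂ : VP ℂ = VNP ℂ → ∃ A : ∀ m : ℕ, MvPolynomial (Fin 3 → Fin (qOf m)) ℂ,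
      IsVNPFamily (σ := fun m => Fin 3 → Fin (qOf m)) A ∧ ∃ m₁, ∀ m, m₁ ≤ m → A m ≠ 0 ∧ bind₁ (kiPer m) (A m) = 0) :
    VP ℂ ≠ VNP ℂ := by
  intro hEq
  obtain ⟨Q, hQ, m₁, hann⟩ := h₂ hEq
  have hVNP : PolyFamily.ofFintype Q ∈ VNP ℂ := (mem_VNP_ofFintype_iff_holds Q).2 hQ
  rw [← hEq] at hVNP
  obtain ⟨⟨-, ⟨d, hd⟩⟩, ⟨c, hc⟩⟩ := (mem_VP_ofFintype_iff_holds Q).1 hVNP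
  obtain ⟨m, hm, hhit⟩ := h₁ (c + d + 1) m₁
  obtain ⟨hQ0, hQann⟩ := hann m hm
  refine hhit (Q m) hQ0 ?_ ?_ hQann
  · exact (hc m).trans (pow_add_le_qOf_pow m c d)
  · rw [show c + d + 1 = d + c + 1 by omega]
    exact (hd m).trans (pow_add_le_qOf_pow m d c)

/-! ### 2. The CH cut: glue and the lift modulo GRH -/

/-- Base change `ℤ → ℂ` of a nonzero polynomial is nonzero. [folklore] -/
theorem map_intCast_ne_zero {σ : Type*} {A : MvPolynomial σ ℤ} (hA : A ≠ 0) :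
    map (Int.castRingHom ℂ) A ≠ 0 := fun h0 =>
  hA (map_injective (Int.castRingHom ℂ) Int.cast_injective (h0.trans (map_zero _).symm))

/-- **GLUE of the CH cut (kernel): `K2ch → LiftCH → K2c`** — under the collapse, LiftCH puts the base change of the
`CH/poly`-definable integer annihilator family into `VNP_ℂ`; it is eventually nonzero and annihilates `G_m`. This is the proof of the
`--glue` item of `route edit … --split KIAnnihilatorDefinableOnCollapse --into KIAnnihilatorCHDefinable CollapseLiftsCH`.
[cite: KoiranPerifel2011, Lemma 4] -/
theorem k2c_of_chCut
    (hK : ∃ A : ∀ m : ℕ, MvPolynomial (Fin 3 → Fin (qOf m)) ℤ,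
      IsPFamily (σ := fun m => Fin 3 → Fin (qOf m)) A ∧ IsCoeffDefinableIn (polyAdvice CH) A ∧
        ∃ m₁, ∀ m, m₁ ≤ m → A m ≠ 0 ∧ bind₁ (kiPer m) (map (Int.castRingHom ℂ) (A m)) = 0)
    (hL : VP ℂ = VNP ℂ → ∀ A : ∀ m : ℕ, MvPolynomial (Fin 3 → Fin (qOf m)) ℤ,
      IsPFamily (σ := fun m => Fin 3 → Fin (qOf m)) A → IsCoeffDefinableIn (polyAdvice CH) A →
        IsVNPFamily (σ := fun m => Fin 3 → Fin (qOf m)) (fun m => map (Int.castRingHom ℂ) (A m))) :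
    VP ℂ = VNP ℂ → ∃ A : ∀ m : ℕ, MvPolynomial (Fin 3 → Fin (qOf m)) ℂ,
      IsVNPFamily (σ := fun m => Fin 3 → Fin (qOf m)) A ∧ ∃ m₁, ∀ m, m₁ ≤ m → A m ≠ 0 ∧ bind₁ (kiPer m) (A m) = 0 := by
  intro hEq
  obtain ⟨A, hP, hdef, m₁, hann⟩ := hK
  exact ⟨fun m => map (Int.castRingHom ℂ) (A m), hL hEq A hP hdef, m₁,
    fun m hm => ⟨map_intCast_ne_zero (hann m hm).1, (hann m hm).2⟩⟩

/-- **`K1 → K2ch → LiftCH → VP_ℂ ≠ VNP_ℂ`** (the route's `closes` after the CH cut). [cite: KabanetsImpagliazzo2003, Thm. 7.7] -/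
theorem vh_of_chCut
    (h₁ : ∀ b m₀ : ℕ, ∃ m, m₀ ≤ m ∧ ∀ D : MvPolynomial (Fin 3 → Fin (qOf m)) ℂ, D ≠ 0 →
      complexity D ≤ qOf m ^ b → D.totalDegree ≤ qOf m ^ b → bind₁ (kiPer m) D ≠ 0)
    (hK : ∃ A : ∀ m : ℕ, MvPolynomial (Fin 3 → Fin (qOf m)) ℤ,
      IsPFamily (σ := fun m => Fin 3 → Fin (qOf m)) A ∧ IsCoeffDefinableIn (polyAdvice CH) A ∧
        ∃ m₁, ∀ m, m₁ ≤ m → A m ≠ 0 ∧ bind₁ (kiPer m) (map (Int.castRingHom ℂ) (A m)) = 0)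
    (hL : VP ℂ = VNP ℂ → ∀ A : ∀ m : ℕ, MvPolynomial (Fin 3 → Fin (qOf m)) ℤ,
      IsPFamily (σ := fun m => Fin 3 → Fin (qOf m)) A → IsCoeffDefinableIn (polyAdvice CH) A →
        IsVNPFamily (σ := fun m => Fin 3 → Fin (qOf m)) (fun m => map (Int.castRingHom ℂ) (A m))) :
    VP ℂ ≠ VNP ℂ :=
  vh_of_kiPlantedHitting_of_k2c h₁ (k2c_of_chCut hK hL)

/-- **Boolean half of LiftCH: under GRH the collapse gives `CH/poly ⊆ P/poly`** — from the input `ERH → VP_ℂ = VNP_ℂ → PP ⊆ P/poly`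
(statement of the tree theorem `PP_subset_PPoly_of_VP_eq_VNP ℂ`, Bürgisser 2000 TCS Cor. 1.2(1)) by the tree theorems
`CH_subset_PPoly_of_PP_subset_PPoly_holds` (Bürgisser, ECCC TR06-113 Lemma 2.5 = STACS 2007 Lemma 5), `polyAdvice_mono` and
`polyAdvice_PPoly_subset_PPoly`. [cite: Burgisser2006, Lemma 2.5; Burgisser2000TCS, Cor. 1.2(1)] -/
theorem polyAdvice_CH_subset_PPoly_of_collapse
    (hB : Literature.NumberTheory.LFunctions.ExtendedRiemannHypothesis → VP ℂ = VNP ℂ → PP ⊆ PPoly)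
    (hGRH : Literature.NumberTheory.LFunctions.ExtendedRiemannHypothesis) (hEq : VP ℂ = VNP ℂ) :
    polyAdvice CH ⊆ PPoly :=
  (polyAdvice_mono (CH_subset_PPoly_of_PP_subset_PPoly_holds (hB hGRH hEq))).trans polyAdvice_PPoly_subset_PPoly

/-- **LiftCH modulo GRH**: from `ERH → VP = VNP → PP ⊆ P/poly`, `ERH`, and Valiant's criterion in coefficient-language form
(`IsPFamily A → IsCoeffDefinableIn PPoly A → map ∘ A ∈ VNP_ℂ`; Bürgisser 2000 Prop. 2.20 / 2024 survey Prop. 2.27 with Cor. 4.7),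
conclude LiftCH. [cite: Burgisser2024Completeness, Thm. 4.10(2); KoiranPerifel2011, Lemma 2-4; ChatterjeeTengse2023, Prop. 2.27] -/
theorem collapseLiftsCH_of_GRH
    (hB : Literature.NumberTheory.LFunctions.ExtendedRiemannHypothesis → VP ℂ = VNP ℂ → PP ⊆ PPoly)
    (hGRH : Literature.NumberTheory.LFunctions.ExtendedRiemannHypothesis)
    (hVC : ∀ A : ∀ m : ℕ, MvPolynomial (Fin 3 → Fin (qOf m)) ℤ,
      IsPFamily (σ := fun m => Fin 3 → Fin (qOf m)) A → IsCoeffDefinableIn PPoly A →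
        IsVNPFamily (σ := fun m => Fin 3 → Fin (qOf m)) (fun m => map (Int.castRingHom ℂ) (A m))) :
    VP ℂ = VNP ℂ → ∀ A : ∀ m : ℕ, MvPolynomial (Fin 3 → Fin (qOf m)) ℤ,
      IsPFamily (σ := fun m => Fin 3 → Fin (qOf m)) A → IsCoeffDefinableIn (polyAdvice CH) A →
        IsVNPFamily (σ := fun m => Fin 3 → Fin (qOf m)) (fun m => map (Int.castRingHom ℂ) (A m)) :=
  fun hEq A hP hdef => hVC A hP (hdef.mono (polyAdvice_CH_subset_PPoly_of_collapse hB hGRH hEq))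

/-- LiftCH is S-implied (vacuous when `VP_ℂ ≠ VNP_ℂ`) — its tag WEAKER. [folklore] -/
theorem collapseLiftsCH_of_vh (hV : VP ℂ ≠ VNP ℂ) :
    VP ℂ = VNP ℂ → ∀ A : ∀ m : ℕ, MvPolynomial (Fin 3 → Fin (qOf m)) ℤ,
      IsPFamily (σ := fun m => Fin 3 → Fin (qOf m)) A → IsCoeffDefinableIn (polyAdvice CH) A →
        IsVNPFamily (σ := fun m => Fin 3 → Fin (qOf m)) (fun m => map (Int.castRingHom ℂ) (A m)) :=
  fun hEq => absurd hEq hV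

/-! ### 3. The definability dial -/

/-- Monotonicity of the dial: a `K`-definable integer annihilator family is `K'`-definable for `K ⊆ K'`; in particular uniform `CH`
gives `CH/poly` (`CH_subset_polyAdvice_CH`) and `PSPACE/poly ⊆ CH/poly` would turn the PSPACE notch (coefficient form of the landed rung
`k2c_vpspace0b_rung`) into K2ch — so a refutation of K2ch separates `PSPACE/poly` from `CH/poly`.
[cite: Burgisser2006, Def. 3.1; ChatterjeeTengse2023, Prop. 2.26-2.27] -/
theorem kiAnnihilatorDefinableIn_mono {K K' : Set (Language Bool)} (hKK' : K ⊆ K')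
    (h : ∃ A : ∀ m : ℕ, MvPolynomial (Fin 3 → Fin (qOf m)) ℤ,
      IsPFamily (σ := fun m => Fin 3 → Fin (qOf m)) A ∧ IsCoeffDefinableIn K A ∧
        ∃ m₁, ∀ m, m₁ ≤ m → A m ≠ 0 ∧ bind₁ (kiPer m) (map (Int.castRingHom ℂ) (A m)) = 0) :
    ∃ A : ∀ m : ℕ, MvPolynomial (Fin 3 → Fin (qOf m)) ℤ,
      IsPFamily (σ := fun m => Fin 3 → Fin (qOf m)) A ∧ IsCoeffDefinableIn K' A ∧
        ∃ m₁, ∀ m, m₁ ≤ m → A m ≠ 0 ∧ bind₁ (kiPer m) (map (Int.castRingHom ℂ) (A m)) = 0 := by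
  obtain ⟨A, hP, hdef, hann⟩ := h
  exact ⟨A, hP, hdef.mono hKK', hann⟩

/-- The strongest notch: a `P/poly`-definable integer annihilator family gives the UNCONDITIONAL aside K2u
(`Theses.DefinabilityGap.KIAnnihilatorDefinable`, item 23737, in `kiPer` form) by Valiant's criterion alone — no collapse, no GRH.
[cite: Burgisser2000, Prop. 2.20] -/
theorem kiAnnihilatorDefinable_of_PPoly
    (hVC : ∀ A : ∀ m : ℕ, MvPolynomial (Fin 3 → Fin (qOf m)) ℤ,
      IsPFamily (σ := fun m => Fin 3 → Fin (qOf m)) A → IsCoeffDefinableIn PPoly A →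
        IsVNPFamily (σ := fun m => Fin 3 → Fin (qOf m)) (fun m => map (Int.castRingHom ℂ) (A m)))
    (h : ∃ A : ∀ m : ℕ, MvPolynomial (Fin 3 → Fin (qOf m)) ℤ,
      IsPFamily (σ := fun m => Fin 3 → Fin (qOf m)) A ∧ IsCoeffDefinableIn PPoly A ∧
        ∃ m₁, ∀ m, m₁ ≤ m → A m ≠ 0 ∧ bind₁ (kiPer m) (map (Int.castRingHom ℂ) (A m)) = 0) :
    ∃ A : ∀ m : ℕ, MvPolynomial (Fin 3 → Fin (qOf m)) ℂ,
      IsVNPFamily (σ := fun m => Fin 3 → Fin (qOf m)) A ∧ ∃ m₁, ∀ m, m₁ ≤ m → A m ≠ 0 ∧ bind₁ (kiPer m) (A m) = 0 := by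
  obtain ⟨A, hP, hdef, m₁, hann⟩ := h
  exact ⟨fun m => map (Int.castRingHom ℂ) (A m), hVC A hP hdef, m₁,
    fun m hm => ⟨map_intCast_ne_zero (hann m hm).1, (hann m hm).2⟩⟩

end Summit.ValiantsHypothesis.ValiantsHypothesis.Theorems.DefinabilityGapCHCut

end
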